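import Summits.CriticalPhenomena.PercolationContinuityZ3.Theorems.PercRayRenewalTwoArmsRatioExponentFiniteSizeCriterion
import Summits.CriticalPhenomena.PercolationContinuityZ3.Theorems.NearLinearTwoClusterDecay.Negative.Structure
import Summits.CriticalPhenomena.PercolationContinuityZ3.Theorems.NearLinearTwoClusterDecay.Negative.Rays
import Summits.CriticalPhenomena.PercolationContinuityZ3.Theorems.PercRayRenewalAssembly

/-!
# Crux `PercRayRenewal.TwoArmsRatioExponent` (stmt-CriticalPhenomena-4625) — DOMINANCE over the sibling
# cruxes and the jump-world reduction (importable form of the lead workfile `Cruxes/…/Dominance.lean`)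

Line `registered`, leads c2 (workfile, 2026-08-17T09Z) and c3 (this Theorems file, cycle 3).  Bond
percolation on `ℤ³` at `p_c` (`critBond`); `A₂(k, m) = twoClusterEvt k m`; `AtExponent α` = decay of
`P(A₂(n, ⌈n^α⌉))`; `outer(s, n) = (· ∩ E(Λ s)ᶜ) ⁻¹' A₂(s, n)` (the thinned event of the registered stub
FS = `stub_finiteSizeCriterion`).

* `twoArmsRatioExponent_iff` — the crux in sibling vocabulary (`twoClusterEvt`).
* `unitBox_law_of_twoArmsRatioExponent` — `T2 ⇒ P(A₂(1, n)) ≤ C n^{-c}`, `c > 1` (pointwise law).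
* `atExponent_of_twoArmsRatioExponent` — `T2 ⇒ AtExponent α` for every `α > 1`; hence the registered
  sub-goal **`critBoxTwoArmsDecay_of_twoArmsRatioExponent` : T2 ⇒ `PercFiniteBoxLRO.CritBoxTwoArmsDecay`**
  (crux stmt-CriticalPhenomena-0859) and `nearLinearTwoClusterDecay_of_twoArmsRatioExponent` : T2 ⇒
  `PercShatteringRace.NearLinearTwoClusterDecay` (crux stmt-CriticalPhenomena-5785): T2 is STRONGER than
  both open sibling cruxes (rigorous frontier there: `AtExponent A` for `A ≥ 44` only,
  `NearLinearTwoClusterDecay.CritFrontier.atExponent_status_44`).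
* `atExponent_of_fs_eps`, `critBoxTwoArmsDecay_of_fs_eps`, `nearLinearTwoClusterDecay_of_fs_eps` — the
  finite-size criterion with ANY power saving `ε > 0` (in place of `c > 1`) already closes both siblings;
  `atExponent_of_outer_le_one_sub` (+ corollaries) — indeed any uniform bound `P(outer(s, M s)) ≤ 1 - η`
  at ONE aspect ratio does (sub-multiplicativity turns non-certainty into a polynomial rate).
* `percolationContinuityZ3_of_jumpWorld_twoArmsRatioExponent` — with the PROVED `Assembly`
  (`percRayRenewalAssembly_proof`) the sub-problem follows from the JUMP-WORLD form
  `0 < θ(p_c) → T2` and `JumpLineAvoidanceDecay`: the route over-demands T2.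

Sorry-free; no definitions.
-/

namespace Summit.CriticalPhenomena.PercolationContinuityZ3.Theorems.TwoArmsRatioExponent

open MeasureTheory Filter Topology
open Literature.Probability.LatticeModels Literature.Probability.Percolation
open Summit.CriticalPhenomena.PercolationContinuityZ3.Theses
open Summit.CriticalPhenomena.PercolationContinuityZ3.Theorems.NearLinearTwoClusterDecay.Negative
open Summit.CriticalPhenomena.PercolationContinuityZ3.Theorems.TwoArmsRatioExponent

noncomputable section

/-- **The crux in sibling vocabulary**: `TwoArmsRatioExponent ↔ ∃ c > 1, C, ∀ 1 ≤ r ≤ n,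
P_{p_c}(twoClusterEvt r n) ≤ C (r/n)^c`. [folklore] -/
theorem twoArmsRatioExponent_iff :
    PercRayRenewal.TwoArmsRatioExponent ↔
      ∃ c C : ℝ, 1 < c ∧ ∀ r n : ℕ, 1 ≤ r → r ≤ n →
        critBond.real (twoClusterEvt r n) ≤ C * ((r : ℝ) / n) ^ c := by
  unfold PercRayRenewal.TwoArmsRatioExponent
  simp only [setOf_stubEvt_eq_twoClusterEvt]

/-- **`T2 ⇒` the pointwise unit-box two-arms law** `P(twoClusterEvt 1 n) ≤ C n^{-c}`, `c > 1`
(the instance `r = 1`). [folklore] -/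
theorem unitBox_law_of_twoArmsRatioExponent (h : PercRayRenewal.TwoArmsRatioExponent) :
    ∃ c C : ℝ, 1 < c ∧ ∀ n : ℕ, 1 ≤ n →
      critBond.real (twoClusterEvt 1 n) ≤ C * (n : ℝ) ^ (-c) := by
  obtain ⟨c, C, hc, hP⟩ := twoArmsRatioExponent_iff.1 h
  refine ⟨c, C, hc, fun n hn => ?_⟩
  have h1 := hP 1 n le_rfl hn
  have hn0 : (0 : ℝ) < n := by exact_mod_cast hn
  calc critBond.real (twoClusterEvt 1 n) ≤ C * (((1 : ℕ) : ℝ) / n) ^ c := h1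
    _ = C * (n : ℝ) ^ (-c) := by
        rw [Nat.cast_one, one_div, Real.inv_rpow hn0.le, Real.rpow_neg hn0.le]

/-- **`T2 ⇒ AtExponent α` for every `α > 1`**: along `m = ⌈n^α⌉`,
`P(twoClusterEvt n m) ≤ C (n/m)^c ≤ C n^{-(α-1)c} → 0`. [folklore] -/
theorem atExponent_of_twoArmsRatioExponent (h : PercRayRenewal.TwoArmsRatioExponent) {α : ℝ}
    (hα : 1 < α) : AtExponent α := by
  obtain ⟨c, C, hc, hP⟩ := twoArmsRatioExponent_iff.1 h
  have hc0 : 0 < c := zero_lt_one.trans hc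
  -- the comparison sequence `C * n^{(1-α)c} → 0`
  have hlim : Tendsto (fun n : ℕ => C * ((n : ℝ) ^ ((1 - α) * c))) atTop (𝓝 0) := by
    have hneg : (1 - α) * c < 0 := mul_neg_of_neg_of_pos (by linarith) hc0
    have h0 : Tendsto (fun n : ℕ => (n : ℝ) ^ (-(-((1 - α) * c)))) atTop (𝓝 0) :=
      (tendsto_rpow_neg_atTop (neg_pos.2 hneg)).comp tendsto_natCast_atTop_atTop
    simp only [neg_neg] at h0
    simpa using h0.const_mul C
  refine squeeze_zero' (Eventually.of_forall fun n => measureReal_nonneg) ?_ hlim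
  filter_upwards [eventually_ge_atTop 1] with n hn
  have hn' : (1 : ℝ) ≤ n := by exact_mod_cast hn
  have hn0 : (0 : ℝ) < n := by positivity
  have hnm : n ≤ ⌈(n : ℝ) ^ α⌉₊ := le_ceil_rpow hn hα.le
  have hmain := hP n ⌈(n : ℝ) ^ α⌉₊ hn hnm
  -- `(n / ⌈n^α⌉)^c ≤ (n^{1-α})^c = n^{(1-α)c}`
  have hCnonneg : 0 ≤ C := by
    -- from the instance r = n = 1: 0 < P ≤ C * 1
    have h11 := hP 1 1 le_rfl le_rfl
    have hpos : 0 < critBond.real (twoClusterEvt 1 1) := real_twoClusterEvt_pos le_rfl le_rfl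
    have : (0 : ℝ) < C * (((1 : ℕ) : ℝ) / ((1 : ℕ) : ℝ)) ^ c := hpos.trans_le h11
    simpa using this.le
  have hratio : ((n : ℝ) / ⌈(n : ℝ) ^ α⌉₊) ≤ (n : ℝ) ^ (1 - α) := by
    have hceil : (n : ℝ) ^ α ≤ ⌈(n : ℝ) ^ α⌉₊ := Nat.le_ceil _
    have hpow : 0 < (n : ℝ) ^ α := Real.rpow_pos_of_pos hn0 α
    calc (n : ℝ) / ⌈(n : ℝ) ^ α⌉₊ ≤ (n : ℝ) / (n : ℝ) ^ α :=
          div_le_div_of_nonneg_left hn0.le hpow hceil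
      _ = (n : ℝ) ^ (1 - α) := by
          rw [Real.rpow_sub hn0, Real.rpow_one]
  have hρ0 : 0 ≤ (n : ℝ) / ⌈(n : ℝ) ^ α⌉₊ := by positivity
  calc critBond.real (twoClusterEvt n ⌈(n : ℝ) ^ α⌉₊)
      ≤ C * ((n : ℝ) / ⌈(n : ℝ) ^ α⌉₊) ^ c := hmain
    _ ≤ C * ((n : ℝ) ^ (1 - α)) ^ c :=
        mul_le_mul_of_nonneg_left (Real.rpow_le_rpow hρ0 hratio hc0.le) hCnonneg
    _ = C * (n : ℝ) ^ ((1 - α) * c) := by rw [← Real.rpow_mul hn0.le]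

/-- **DOMINANCE I: `T2 ⇒ CritBoxTwoArmsDecay` (crux stmt-CriticalPhenomena-0859, route
`PercFiniteBoxLRO`: decay at every aspect exponent `α > 1`).** [folklore] -/
theorem critBoxTwoArmsDecay_of_twoArmsRatioExponent : Summit.CriticalPhenomena.PercolationContinuityZ3.Theses.PercRayRenewal.TwoArmsRatioExponent → Summit.CriticalPhenomena.PercolationContinuityZ3.Theses.PercFiniteBoxLRO.CritBoxTwoArmsDecay :=
  fun h => critBoxTwoArmsDecay_iff.2 fun _ hα => atExponent_of_twoArmsRatioExponent h hα

/-- **DOMINANCE II: `T2 ⇒ NearLinearTwoClusterDecay` (crux stmt-CriticalPhenomena-5785, route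
`PercShatteringRace`: the instance `α = 7/6`).** [folklore] -/
theorem nearLinearTwoClusterDecay_of_twoArmsRatioExponent
    (h : PercRayRenewal.TwoArmsRatioExponent) : PercShatteringRace.NearLinearTwoClusterDecay :=
  nearLinearTwoClusterDecay_iff.2 (atExponent_of_twoArmsRatioExponent h (by norm_num))

/-! ## The finite-size criterion with any power saving gives the sibling cruxes -/

/-- **FS_ε ⇒ `AtExponent α` for every `α > 1`.**  If at one aspect ratio `M ≥ 2` the thinned
two-distinct-crossings probability has ANY uniform power saving, `P(outer(s, M s)) ≤ M^{-ε}` for all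
`s ≥ s₀` with `ε > 0`, then `P(twoClusterEvt n ⌈n^α⌉) ≤ M^ε n^{-(α-1)ε} → 0`. [folklore] -/
theorem atExponent_of_fs_eps {M s₀ : ℕ} (hM : 2 ≤ M) (hs₀ : 1 ≤ s₀) {ε : ℝ} (hε : 0 < ε)
    (h : ∀ s : ℕ, s₀ ≤ s → critBond.real ((fun ω : BondConfig (Site 3) =>
      ω ∩ (Set.sym2 (↑(box 3 s) : Set (Site 3)))ᶜ) ⁻¹' twoClusterEvt s (M * s)) ≤ (M : ℝ) ^ (-ε))
    {α : ℝ} (hα : 1 < α) : AtExponent α := by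
  have hMpos : (0 : ℝ) < M := by exact_mod_cast (lt_of_lt_of_le (by norm_num) hM : 0 < M)
  -- comparison sequence `M^ε * n^{(1-α)ε} → 0`
  have hlim : Tendsto (fun n : ℕ => (M : ℝ) ^ ε * ((n : ℝ) ^ ((1 - α) * ε))) atTop (𝓝 0) := by
    have hneg : (1 - α) * ε < 0 := mul_neg_of_neg_of_pos (by linarith) hε
    have h0 : Tendsto (fun n : ℕ => (n : ℝ) ^ (-(-((1 - α) * ε)))) atTop (𝓝 0) :=
      (tendsto_rpow_neg_atTop (neg_pos.2 hneg)).comp tendsto_natCast_atTop_atTop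
    simp only [neg_neg] at h0
    simpa using h0.const_mul ((M : ℝ) ^ ε)
  refine squeeze_zero' (Eventually.of_forall fun n => measureReal_nonneg) ?_ hlim
  filter_upwards [eventually_ge_atTop s₀] with n hn
  have hn1 : 1 ≤ n := hs₀.trans hn
  have hn' : (1 : ℝ) ≤ n := by exact_mod_cast hn1
  have hn0 : (0 : ℝ) < n := by positivity
  have hnm : n ≤ ⌈(n : ℝ) ^ α⌉₊ := le_ceil_rpow hn1 hα.le
  have hmain := real_twoClusterEvt_le_of_fs hM hε.le h hn1 hn hnm
  have hratio : ((n : ℝ) / ⌈(n : ℝ) ^ α⌉₊) ≤ (n : ℝ) ^ (1 - α) := by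
    have hceil : (n : ℝ) ^ α ≤ ⌈(n : ℝ) ^ α⌉₊ := Nat.le_ceil _
    have hpow : 0 < (n : ℝ) ^ α := Real.rpow_pos_of_pos hn0 α
    calc (n : ℝ) / ⌈(n : ℝ) ^ α⌉₊ ≤ (n : ℝ) / (n : ℝ) ^ α :=
          div_le_div_of_nonneg_left hn0.le hpow hceil
      _ = (n : ℝ) ^ (1 - α) := by rw [Real.rpow_sub hn0, Real.rpow_one]
  have hρ0 : 0 ≤ (n : ℝ) / ⌈(n : ℝ) ^ α⌉₊ := by positivity
  calc critBond.real (twoClusterEvt n ⌈(n : ℝ) ^ α⌉₊)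
      ≤ (M : ℝ) ^ ε * ((n : ℝ) / ⌈(n : ℝ) ^ α⌉₊) ^ ε := hmain
    _ ≤ (M : ℝ) ^ ε * ((n : ℝ) ^ (1 - α)) ^ ε :=
        mul_le_mul_of_nonneg_left (Real.rpow_le_rpow hρ0 hratio hε.le) (Real.rpow_nonneg hMpos.le ε)
    _ = (M : ℝ) ^ ε * (n : ℝ) ^ ((1 - α) * ε) := by rw [← Real.rpow_mul hn0.le]

/-- **FS_ε ⇒ `CritBoxTwoArmsDecay` (stmt-CriticalPhenomena-0859).** [folklore] -/
theorem critBoxTwoArmsDecay_of_fs_eps {M s₀ : ℕ} (hM : 2 ≤ M) (hs₀ : 1 ≤ s₀) {ε : ℝ} (hε : 0 < ε)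
    (h : ∀ s : ℕ, s₀ ≤ s → critBond.real ((fun ω : BondConfig (Site 3) =>
      ω ∩ (Set.sym2 (↑(box 3 s) : Set (Site 3)))ᶜ) ⁻¹' twoClusterEvt s (M * s)) ≤ (M : ℝ) ^ (-ε)) :
    PercFiniteBoxLRO.CritBoxTwoArmsDecay :=
  critBoxTwoArmsDecay_iff.2 fun _ hα => atExponent_of_fs_eps hM hs₀ hε h hα

/-- **FS_ε ⇒ `NearLinearTwoClusterDecay` (stmt-CriticalPhenomena-5785).** [folklore] -/
theorem nearLinearTwoClusterDecay_of_fs_eps {M s₀ : ℕ} (hM : 2 ≤ M) (hs₀ : 1 ≤ s₀) {ε : ℝ}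
    (hε : 0 < ε)
    (h : ∀ s : ℕ, s₀ ≤ s → critBond.real ((fun ω : BondConfig (Site 3) =>
      ω ∩ (Set.sym2 (↑(box 3 s) : Set (Site 3)))ᶜ) ⁻¹' twoClusterEvt s (M * s)) ≤ (M : ℝ) ^ (-ε)) :
    PercShatteringRace.NearLinearTwoClusterDecay :=
  nearLinearTwoClusterDecay_iff.2 (atExponent_of_fs_eps hM hs₀ hε h (by norm_num))

/-! ## Uniform non-certainty of the thinned event at ONE aspect ratio already gives the siblings -/

/-- **Any uniform bound `< 1` at one aspect ratio closes stmt-0859 and stmt-5785.**  If for some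
`M ≥ 2`, `s₀` and `η ∈ (0, 1)` the thinned two-distinct-crossings probability satisfies
`P(outer(s, M s)) ≤ 1 - η` for all `s ≥ s₀`, then `AtExponent α` for every `α > 1` (take
`ε = -log(1-η)/log M > 0`, so that `M^{-ε} = 1 - η`, in `atExponent_of_fs_eps`): sub-multiplicativity
turns mere uniform non-certainty into a polynomial rate. [folklore] -/
theorem atExponent_of_outer_le_one_sub {M s₀ : ℕ} (hM : 2 ≤ M) (hs₀ : 1 ≤ s₀) {η : ℝ} (hη : 0 < η)
    (hη1 : η < 1)
    (h : ∀ s : ℕ, s₀ ≤ s → critBond.real ((fun ω : BondConfig (Site 3) =>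
      ω ∩ (Set.sym2 (↑(box 3 s) : Set (Site 3)))ᶜ) ⁻¹' twoClusterEvt s (M * s)) ≤ 1 - η)
    {α : ℝ} (hα : 1 < α) : AtExponent α := by
  have hMpos : (0 : ℝ) < M := by exact_mod_cast (lt_of_lt_of_le (by norm_num) hM : 0 < M)
  have hM1 : (1 : ℝ) < M := by exact_mod_cast (lt_of_lt_of_le (by norm_num) hM : 1 < M)
  have hlogM : 0 < Real.log M := Real.log_pos hM1
  have h1η : 0 < 1 - η := by linarith
  have hlogη : Real.log (1 - η) < 0 := Real.log_neg h1η (by linarith)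
  set ε : ℝ := -Real.log (1 - η) / Real.log M with hε
  have hεpos : 0 < ε := by
    rw [hε]; exact div_pos (neg_pos.2 hlogη) hlogM
  have hMε : (M : ℝ) ^ (-ε) = 1 - η := by
    rw [Real.rpow_def_of_pos hMpos, hε]
    have : Real.log M * -(-Real.log (1 - η) / Real.log M) = Real.log (1 - η) := by
      field_simp
    rw [this, Real.exp_log h1η]
  refine atExponent_of_fs_eps hM hs₀ hεpos (fun s hs => ?_) hα
  rw [hMε]; exact h s hs

/-- **Corollary for stmt-0859** (`CritBoxTwoArmsDecay`) from uniform non-certainty at one aspect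
ratio. [folklore] -/
theorem critBoxTwoArmsDecay_of_outer_le_one_sub {M s₀ : ℕ} (hM : 2 ≤ M) (hs₀ : 1 ≤ s₀) {η : ℝ}
    (hη : 0 < η) (hη1 : η < 1)
    (h : ∀ s : ℕ, s₀ ≤ s → critBond.real ((fun ω : BondConfig (Site 3) =>
      ω ∩ (Set.sym2 (↑(box 3 s) : Set (Site 3)))ᶜ) ⁻¹' twoClusterEvt s (M * s)) ≤ 1 - η) :
    PercFiniteBoxLRO.CritBoxTwoArmsDecay :=
  critBoxTwoArmsDecay_iff.2 fun _ hα => atExponent_of_outer_le_one_sub hM hs₀ hη hη1 h hα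

/-- **Corollary for stmt-5785** (`NearLinearTwoClusterDecay`) from uniform non-certainty at one
aspect ratio. [folklore] -/
theorem nearLinearTwoClusterDecay_of_outer_le_one_sub {M s₀ : ℕ} (hM : 2 ≤ M) (hs₀ : 1 ≤ s₀)
    {η : ℝ} (hη : 0 < η) (hη1 : η < 1)
    (h : ∀ s : ℕ, s₀ ≤ s → critBond.real ((fun ω : BondConfig (Site 3) =>
      ω ∩ (Set.sym2 (↑(box 3 s) : Set (Site 3)))ᶜ) ⁻¹' twoClusterEvt s (M * s)) ≤ 1 - η) :
    PercShatteringRace.NearLinearTwoClusterDecay :=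
  nearLinearTwoClusterDecay_iff.2 (atExponent_of_outer_le_one_sub hM hs₀ hη hη1 h (by norm_num))

/-! ## The route needs T2 only in the jump world (proved-Assembly form) -/

/-- **Jump-world T2 and `JumpLineAvoidanceDecay` give the sub-problem**, by the PROVED `Assembly`
(`percRayRenewalAssembly_proof : T2 → G → θ(p_c) = 0`): if `θ(p_c) ≠ 0` then `θ(p_c) > 0`, so T2
holds and the Assembly yields `θ(p_c) = 0` — contradiction.  Hence the planners may restate the crux as
`0 < theta (zdGraph 3) 0 (criticalProbI 3) → TwoArmsRatioExponent` (vacuous if the summit is true,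
immune to the `d > 6` objection). [folklore] -/
theorem percolationContinuityZ3_of_jumpWorld_twoArmsRatioExponent
    (hT2j : 0 < theta (zdGraph 3) (0 : Site 3) (criticalProbI 3) → PercRayRenewal.TwoArmsRatioExponent)
    (hG : PercRayRenewal.JumpLineAvoidanceDecay) : _root_.PercolationContinuityZ3 := by
  by_contra h
  have hne : theta (zdGraph 3) (0 : Site 3) (criticalProbI 3) ≠ 0 := fun h0 =>
    h (Literature.Probability.Percolation.percolationContinuityZ3_iff.2 h0)
  have hθ : 0 < theta (zdGraph 3) (0 : Site 3) (criticalProbI 3) :=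
    lt_of_le_of_ne (by unfold theta; exact measureReal_nonneg) (Ne.symm hne)
  exact h (percRayRenewalAssembly_proof (hT2j hθ) hG)

end

end Summit.CriticalPhenomena.PercolationContinuityZ3.Theorems.TwoArmsRatioExponent
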